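import Summits.ResolutionOfSingularities.ResolutionOfSingularities.Theorems.FrobeniusClosingPatchingRelPerfectDepthWeightTwoBLoop
import Summits.ResolutionOfSingularities.ResolutionOfSingularities.Theorems.FrobeniusClosingPatchingRelPerfectDepthWeightTwoBEnd
import Summits.ResolutionOfSingularities.ResolutionOfSingularities.Theorems.FrobeniusClosingPatchingRelPerfectDepthMixedTargetsJR
import Literature.AlgebraicGeometry.Resolution.EmbeddedResolutionExcellentSurfacesSequence
import Literature.AlgebraicGeometry.Resolution.RegularCentreComponents
import Literature.AlgebraicGeometry.Resolution.KollarNmPartBlowup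
import Literature.AlgebraicGeometry.Resolution.BlowupsLocal
import Literature.AlgebraicGeometry.Resolution.NormalCrossingsStrictification
import Literature.AlgebraicGeometry.Resolution.MarkedIdealsEtale
import Literature.Topology.KrullDimensionDrop
import HarnessLib

/-!
# Crux `PatchingRelPerfect` (stmt-ResolutionOfSingularities-16161), chain W5.2 — TargetsF5J(R) T5-E «W₂B-maxweight»:
# the CJS INDUCTION and the target `WeightTwoBoundaryJR₃` BY NAME

[OURS · L1 W5.2 · TargetsF5J(R) T5-E] NOT statements of the manuscript under review; the named fact
`CossartJannsenSaito2020EmbeddedSequenceB` (CJS 2020 Thm. 1.4 / 6.9 (a), F-32bR) enters as a hypothesis INSIDE the target.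
`cjs_transport`: along a sequence of complete `𝓑`-permissible blow-ups over `X = Supp 𝔟` (`IsBPermissibleSequenceB`), the transport
state `StateIn` (…DepthWeightTwoBState) is carried by a weight-`≤ 2` sequence with boundary and reduced host
(`DepthTargets.IsWeightedSeqJR 2`, F5J(R) of record, p515168) on a scheme `E'` ISOMORPHIC to CJS's `Z'` — CJS steps with EMPTY centre are
isomorphisms, which are not weighted steps, and are absorbed into the isomorphism `e : E' ≅ Z'`; a step with non-empty centre `C` is
re-sequenced along the connected pieces of `e^*C` (res-type-049's `WeightTwoB.pieces_loop` over the single-piece step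
`…PieceStep`/`…PieceStepOut`), the piece data coming from CJS's clauses: regularity of the pieces of a regular centre, snc with the
boundary by res-type-019's P3 pushed through `e` (`hasSNCWith_comap_of_isNormalCrossingWith`) and read piecewise
(`HasSNCWith.centrePiece`), permissibility along the stalk isomorphisms of `e` (`isPermissible_map_map_of_ringEquiv`). The END
(`StateIn.endClauses`, …DepthWeightTwoBEnd) and `IsWeightedSeqJR.nil`/`StateIn.init` give `DepthTargets.weightTwoBoundaryJR₃_holds`.

AI-written; AI review is weaker than expert review.

## References
* V. Cossart, U. Jannsen, S. Saito, LNM 2270 (2020), Thm. 1.4, Cor. 1.5, Def. 3.1, Def. 4.1, (6.2), Thm. 6.9 (a). [CossartJannsenSaito2020]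
* E. Bierstone, D. Grigoriev, P. Milman, J. Włodarczyk, arXiv:1206.3090, Def. 3.1.3, §4 Step 2. [BierstoneGrigorievMilmanWlodarczyk2011]
* J. Kollár, *Lectures on Resolution of Singularities* (2007), 3.30.2, (3.111) Steps 1–3. [Kollar2007]
-/

-- `Summit.<Summit>.<Sub>.Theorems` with `Sub = Summit` (single-conjunct summit, D-0017)
set_option linter.dupNamespace false

noncomputable section

open CategoryTheory CategoryTheory.Limits AlgebraicGeometry TopologicalSpace IsLocalRing
open Literature.AlgebraicGeometry.Resolution Scheme.IdealSheafData

namespace Summit.ResolutionOfSingularities.ResolutionOfSingularities.Theorems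

universe u

namespace WeightTwoB

open DepthSNC DepthTargets

/-! ## A blow-up along the empty centre is an isomorphism -/

/-- **The blow-up of the unit ideal sheaf is an isomorphism** (universal property against `𝟙`). [cite: StacksProject, Tag 0806] -/
theorem isIso_of_isBlowup_top {Z'' Z' : Scheme.{u}} {τ : Z'' ⟶ Z'} {C : Z'.IdealSheafData} (hτ : IsBlowup τ C) (hC : C = ⊤) :
    IsIso τ := by
  subst hC
  have h1 : IsEffectiveCartier ((⊤ : Z'.IdealSheafData).comap (𝟙 Z')) := (isBlowup_id_top Z').isEffectiveCartier
  obtain ⟨g, hg, -⟩ := hτ.universal (𝟙 Z') h1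
  obtain ⟨k, -, hku⟩ := hτ.universal τ hτ.isEffectiveCartier
  have hτg : τ ≫ g = 𝟙 Z'' := by
    rw [hku (τ ≫ g) (show (τ ≫ g) ≫ τ = τ by rw [Category.assoc, hg, Category.comp_id]),
      hku (𝟙 Z'') (show 𝟙 Z'' ≫ τ = τ from Category.id_comp τ)]
  exact ⟨g, hτg, hg⟩

/-! ## Set-theoretic bookkeeping -/

/-- Preimage under a composite. [folklore] -/
theorem preimage_comp' {X Y Z : Scheme.{u}} (f : X ⟶ Y) (g : Y ⟶ Z) (A : Set Z) : ⇑(f ≫ g) ⁻¹' A = f ⁻¹' (g ⁻¹' A) := by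
  ext x; simp only [Set.mem_preimage, Scheme.Hom.comp_apply]

/-- `e.inv ⁻¹' (e.hom ⁻¹' A) = A`. [folklore] -/
theorem preimage_inv_preimage_hom {E' Z' : Scheme.{u}} (e : E' ≅ Z') (A : Set Z') : e.inv ⁻¹' (e.hom ⁻¹' A) = A := by
  ext y; simp only [Set.mem_preimage, hom_inv_apply]

/-- `(inv τ) ⁻¹' (τ ⁻¹' A) = A` for an isomorphism `τ`. [folklore] -/
theorem preimage_inv_preimage {Z'' Z' : Scheme.{u}} (τ : Z'' ⟶ Z') [IsIso τ] (A : Set Z') : ⇑(inv τ) ⁻¹' (τ ⁻¹' A) = A := by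
  rw [← preimage_comp', IsIso.inv_hom_id]; ext y; simp

/-- Preimage under the identity. [folklore] -/
theorem preimage_id' {Z : Scheme.{u}} (A : Set Z) : ⇑(𝟙 Z) ⁻¹' A = A := by
  ext y; simp

/-! ## The CJS induction -/

/-- **Transport along the CJS sequence** (see the module docstring): ISO-TOLERANT induction over `IsBPermissibleSequenceB`.
[cite: CossartJannsenSaito2020, Thm. 1.4, (6.2), Def. 3.1, Def. 4.1] [cite: Kollar2007, (3.111) Step 1] -/
theorem cjs_transport {E : Scheme.{u}} [IsIntegral E] [IsNoetherian E] (hE : Scheme.IsRegular E)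
    (𝔟 : E.IdealSheafData) (h𝔟 : 𝔟 ≠ ⊥) (hlp : IsLocallyPrincipal 𝔟) (hred : IsReduced 𝔟.subscheme) :
    ∀ {Z' : Scheme.{u}} {σ : Z' ⟶ E} {X' B' : Set Z'},
      IsBPermissibleSequenceB (𝔟.support : Set E) (∅ : Set E) σ X' B' →
      IsClosed X' ∧ ∃ (E' : Scheme.{u}) (_ : IsIntegral E') (_ : IsNoetherian E') (_ : IsNoetherian Z') (ρ : E' ⟶ E)
        (e : E' ≅ Z') (𝔟' D' : E'.IdealSheafData) (ℬ' 𝒟' : List (E'.IdealSheafData × ℕ)),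
        IsWeightedSeqJR 2 ρ 𝔟 𝔟 [] [] 𝔟' D' ℬ' 𝒟' ∧ StateIn 𝔟' D' ℬ' 𝒟' ∧
        ((D'.support : Set E') = e.hom ⁻¹' closure X') ∧ (∀ p ∈ ℬ', (p.1.support : Set E') ⊆ e.hom ⁻¹' B') := by
  intro Z' σ X' B' h
  induction h with
  | refl =>
    refine ⟨𝔟.support.isClosed, E, inferInstance, inferInstance, inferInstance, 𝟙 E, Iso.refl E, 𝔟, 𝔟, [], [],
      IsWeightedSeqJR.nil 𝔟 𝔟 [] [] (by rw [monomialIdeal_nil, Scheme.IdealSheafData.mul_top]) (fun p hp => by simp at hp),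
      StateIn.init hE h𝔟 hlp hred, ?_, fun p hp => by simp at hp⟩
    rw [𝔟.support.isClosed.closure_eq, Iso.refl_hom, preimage_id']
  | @blowup Z' Z'' σ X' B' _ C τ hτ hreg hsub _ hperm hnc ih =>
    obtain ⟨hX'c, E', hint, hnoeth, hnoethZ, ρ, e, 𝔟', D', ℬ', 𝒟', hseq, S, hsupp, hbd⟩ := ih
    haveI := hint
    haveI := hnoeth
    haveI := hnoethZ
    haveI : IsNoetherian Z'' := isNoetherian_of_isBlowup hτ
    have hclX : closure X' = X' := hX'c.closure_eq
    refine ⟨isClosed_closure, ?_⟩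
    by_cases hC0 : C = ⊤
    · /- EMPTY centre: `τ` is an isomorphism, absorbed into `e` -/
      haveI := isIso_of_isBlowup_top hτ hC0
      have hCs : (C.support : Set Z') = ∅ := by
        rw [hC0, Scheme.IdealSheafData.support_top]; rfl
      refine ⟨E', hint, hnoeth, inferInstance, ρ, e ≪≫ (asIso τ).symm, 𝔟', D', ℬ', 𝒟', hseq, S, ?_, fun p hp => ?_⟩
      · rw [hsupp, hCs, Set.sdiff_empty, hclX, closure_closure, (hX'c.preimage τ.continuous).closure_eq, Iso.trans_hom,
          Iso.symm_hom, asIso_inv, preimage_comp', preimage_inv_preimage]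
      · rw [hCs, Set.union_empty, Iso.trans_hom, Iso.symm_hom, asIso_inv, preimage_comp', preimage_inv_preimage]
        exact hbd p hp
    · /- NON-EMPTY centre: re-sequence along the pieces of `e^* C` on `E'` -/
      have hCne : (C.support : Set Z').Nonempty := by
        rw [Set.nonempty_iff_ne_empty]
        intro h0
        apply hC0
        rw [← Scheme.IdealSheafData.support_eq_bot_iff]
        exact Closeds.ext h0
      -- the centre read on `E'`, and the blow-up `τ ≫ e⁻¹` along it
      have hC₀reg : Scheme.IsRegular (C.comap e.hom).subscheme := isRegular_subscheme_comap_of_isOpenImmersion e.hom C hreg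
      have hτ₀ : IsBlowup (τ ≫ e.inv) (C.comap e.hom) := by
        have h := hτ.comp_iso e.symm
        rwa [Iso.symm_hom, Iso.symm_inv] at h
      have hC₀s : ((C.comap e.hom).support : Set E') = e.hom ⁻¹' C.support := by
        rw [support_comap]; rfl
      have hCX : (C.support : Set Z') ⊆ closure X' := by
        intro y hy
        have h : y ∈ ((vanishingIdeal (⟨closure X', isClosed_closure⟩ : Closeds Z')).support : Set Z') :=
          support_antitone hsub hy
        rwa [Scheme.IdealSheafData.coe_support_vanishingIdeal] at h
      have hC₀D : ((C.comap e.hom).support : Set E') ⊆ D'.support := by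
        rw [hC₀s, hsupp]; exact Set.preimage_mono hCX
      -- the pieces of the centre
      have hP : IsPiecePartition (C.comap e.hom) (Kollar2007.boundaryPieces (C.comap e.hom)) :=
        isPiecePartition_boundaryPieces_of_isRegular hC₀reg
      have hne : Kollar2007.boundaryPieces (C.comap e.hom) ≠ [] := by
        intro h0
        rw [boundaryPieces_eq_nil_iff] at h0
        obtain ⟨y, hy⟩ := hCne
        have h : e.inv y ∈ ((C.comap e.hom).support : Set E') := by
          rw [hC₀s, Set.mem_preimage, hom_inv_apply]; exact hy
        rw [h0, Scheme.IdealSheafData.support_top] at h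
        exact h
      -- the boundary has snc with the centre (P3 on `Z'`, pushed through `e`)
      have hsncC : HasSNCWith (boundaryOf ℬ') (C.comap e.hom) :=
        hasSNCWith_comap_of_isNormalCrossingWith e S.sncB
          (fun K hK => by obtain ⟨p, hp, rfl⟩ := List.mem_map.mp hK; exact hbd p hp)
          (eq_vanishingIdeal_support_of_isRegular C hreg) hnc
      -- the reduced host ideal read through `e`
      have hDcomap : (vanishingIdeal (⟨closure X', isClosed_closure⟩ : Closeds Z')).comap e.hom = vanishingIdeal D'.support := by
        rw [comap_hom_vanishingIdeal]; congr 1; exact (Closeds.ext hsupp).symm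
      -- the centre data of every piece
      have hΓ : ∀ Z ∈ Kollar2007.boundaryPieces (C.comap e.hom), CentreIn D' ℬ' Z := fun Z hZ =>
        { irred := isIrreducible_of_mem_boundaryPieces hZ
          regZ := isRegular_subscheme_vanishingIdeal_piece hC₀reg hP hZ
          subZ := fun x hx => hC₀D (hP.subset hZ hx)
          sncZ := hsncC.centrePiece hP hZ
          perm := fun z hz => by
            have hzC₀ : z ∈ ((C.comap e.hom).support : Set E') := hP.subset hZ hz
            have hzC : e.hom z ∈ (C.support : Set Z') := by rwa [hC₀s] at hzC₀
            let φ : Z'.presheaf.stalk (e.hom z) ≃+* E'.presheaf.stalk z := (asIso (e.hom.stalkMap z)).commRingCatIsoToRingEquiv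
            have hφ : (φ : Z'.presheaf.stalk (e.hom z) →+* E'.presheaf.stalk z) = (e.hom.stalkMap z).hom := rfl
            have h := isPermissible_map_map_of_ringEquiv φ (hperm (e.hom z) hzC)
            rw [hφ, ← stalkIdeal_comap_eq_map, ← stalkIdeal_comap_eq_map, hDcomap] at h
            rwa [stalkIdeal_centrePiece_eq hC₀reg hP hZ hz] }
      -- the pieces loop
      obtain ⟨hint'', hnoeth'', 𝔟'', D'', ℬ'', 𝒟'', hseq', S', hsupp', hbd'⟩ :=
        pieces_loop S hseq hC₀reg hne hP hΓ (B₀ := e.hom ⁻¹' (B' ∪ (C.support : Set Z')))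
          (fun p hp => (hbd p hp).trans (Set.preimage_mono Set.subset_union_left))
          (by rw [hC₀s]; exact Set.preimage_mono Set.subset_union_right) hτ₀
      refine ⟨Z'', hint'', hnoeth'', inferInstance, (τ ≫ e.inv) ≫ ρ, Iso.refl Z'', 𝔟'', D'', ℬ'', 𝒟'', hseq', S', ?_,
        fun p hp => ?_⟩
      · rw [hsupp', hsupp, hC₀s, ← Set.preimage_sdiff, preimage_comp', preimage_inv_preimage_hom, hclX, closure_closure,
          Iso.refl_hom, preimage_id']
      · rw [Iso.refl_hom, preimage_id']
        refine (hbd' p hp).trans ?_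
        rw [preimage_comp', preimage_inv_preimage_hom]

/-! ## The target by name -/

/-- **`WeightTwoBoundaryJR₃` by content**: modulo CJS (F-32bR), a non-zero locally principal `𝔟` with reduced zero scheme on an
integral Noetherian regular excellent scheme of dimension three is carried by an `IsWeightedSeqJR 2` sequence from `(𝔟, 𝔟, [], [])`
to an `EndStateJR` datum on an integral Noetherian regular scheme. [cite: CossartJannsenSaito2020, Thm. 1.4, Thm. 6.9 (a), p. 7]
[cite: Kollar2007, (3.111) Steps 1–3] -/
theorem weightTwoBoundaryJR (hCJS : CossartJannsenSaito2020EmbeddedSequenceB.{u})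
    (E : Scheme.{u}) [IsIntegral E] [IsNoetherian E] (hreg : Scheme.IsRegular E) (hexc : Scheme.IsExcellent E)
    (hdim : topologicalKrullDim E = 3) (𝔟 : E.IdealSheafData) (h𝔟 : 𝔟 ≠ ⊥) (hlp : IsLocallyPrincipal 𝔟)
    (hred : IsReduced 𝔟.subscheme) :
    ∃ (E' : Scheme.{u}) (ρ : E' ⟶ E) (𝔟' D' : E'.IdealSheafData) (ℬ' 𝒟' : List (E'.IdealSheafData × ℕ)),
      IsWeightedSeqJR 2 ρ 𝔟 𝔟 [] [] 𝔟' D' ℬ' 𝒟' ∧ IsIntegral E' ∧ IsNoetherian E' ∧ Scheme.IsRegular E' ∧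
        EndStateJR 𝔟' D' ℬ' := by
  -- `X = Supp 𝔟` is closed, `≠ E`, of dimension `≤ 2`
  set X : Set E := (𝔟.support : Set E) with hXdef
  have hXc : IsClosed X := 𝔟.support.isClosed
  have hXne : X ≠ Set.univ := fun hX =>
    not_mem_support_genericPoint h𝔟 (show genericPoint E ∈ X from hX ▸ Set.mem_univ _)
  have hdimX : topologicalKrullDim X ≤ 2 := by
    have hlt := Literature.Topology.topologicalKrullDim_lt_of_isClosed_ssubset hXc hXne (2 + 1)
      (by rw [hdim]; exact_mod_cast (by norm_num : (3 : ℕ) < 2 + 1 + 1))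
    rw [Nat.cast_add_one] at hlt
    exact_mod_cast (ENat.WithBot.lt_add_one_iff.mp hlt)
  -- CJS: the `𝓑`-permissible sequence over `X` and its end clauses
  obtain ⟨Z₁, π, X₁, B₁, hT, -, -, -, -, hX₁, -, -, htr⟩ := hCJS.of_isClosed E hreg hexc X hXc hdimX
  -- transport
  obtain ⟨hX₁c, E', hint, hnoeth, hnoethZ, ρ, e, 𝔟', D', ℬ', 𝒟', hseq, S, hsupp, hbd⟩ :=
    cjs_transport hreg 𝔟 h𝔟 hlp hred hT
  haveI := hint
  haveI := hnoeth
  haveI := hnoethZ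
  obtain ⟨hregD, hsnc⟩ := S.endClauses e hX₁c hX₁ htr hsupp hbd
  exact ⟨E', ρ, 𝔟', D', ℬ', 𝒟', hseq, hint, hnoeth, S.regW, hregD, hsnc, S.fac⟩

end WeightTwoB

namespace DepthTargets

/-- **TARGET T5-E «W₂B» BY NAME** (`WeightTwoBoundaryJR₃`, F5J(R) of record): see `WeightTwoB.weightTwoBoundaryJR`.
[cite: CossartJannsenSaito2020, Thm. 1.4, Thm. 6.9 (a)] [cite: Kollar2007, (3.111) Steps 1–3] -/
theorem weightTwoBoundaryJR₃_holds : WeightTwoBoundaryJR₃.{u} := by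
  intro hCJS E _ _ hreg hexc hdim 𝔟 h𝔟 hlp hred
  exact WeightTwoB.weightTwoBoundaryJR hCJS E hreg hexc hdim 𝔟 h𝔟 hlp hred

end DepthTargets

end Summit.ResolutionOfSingularities.ResolutionOfSingularities.Theorems

end
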